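import Summits.ABC.IUTFork.LDHGenuinePrintIsmDecided
import Summits.ABC.IUTFork.Conditional.AbcOfSCor312OfInhabited
import Literature.IUT.LogVolume.Corollary22RatPointDictionary
import Mathlib.Analysis.Complex.ExponentialBounds
import HarnessLib

/-!
# The fork at [IUTchIII] Corollary 3.12, L-DH level, over PRINT's (Ind2): the ONE TRUE ROW of the inhabited-type census — at the HEX point
# `λ = 1/2 + 2/7 = 11/14` (triple `3 + 11 = 14`), level `l = 11`, BOTH readings (P), (U) over print's factorwise `Ism` HOLD for every
# datum (the row is Szpiro-SHALLOW), and FAIL at `l = 29` — DECIDED BOTH WAYS by part 7's criterion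
# (abc-iut cell, crux ThetaPartII = stmt-ABC-19678; row «C:PERIMAGE-PRINT-ISM», part 9)

Record-only PROOF file (D-0012; no definition, no `Prop` fact) of the abc-iut cell (WAVE-3 discharge seat abc-iut-c312-d1, gen 11; sequel of part 7
`LDHGenuinePrintIsmDecided`, p516974). TAKES NO SIDE on [IUTchIII] Cor. 3.12.

Part 7 DECIDED the print-Ism reading at every genuine datum: TRUE iff `((l+1)/24 − 1/(2l))·log q^{∤{2,l}}(λ) ≤ ((l+5)/4)·log π`. Every §S rational row
of the census and Broberg lie on the FALSE side (parts 3/4/6/8). THIS FILE exhibits the TRUE side inside the SAME inhabited-type census (abc-iut-w6-d102's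
(P6) list engine / abc-iut-C-cert-3's `Hex.nonempty_and_cor312Of_lamSeven_le_six_tabulated`, k = 1):

* `Hex1.jInv_eq` — `j(11/14) = 2⁶·163³/(3·7·11)²`; `Hex1.logQAvoid_pair_of_prime` — `log q^{∤{2,l}}(11/14) = Σ_{p ∈ {3,7,11}∖{l}} 2·log p`
  (this lineage's / abc-iut-S4's `logQAvoid_ratPoint_two_prime_eq_sum`); `Hex1.logQAvoid_pair_eleven_le` — at `l = 11`: `2·log 3 + 2·log 7 ≤ 6.7`
  (`log 2 < 0.6932`, `log x ≤ x − 1`); `Hex1.shallow_eleven` — `κ₁₁·log q^{∤{2,11}} ≤ 4·log π` (`log π > 1`);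
* **`Hex1.nonempty_and_perImage_printInd2_eleven`** / **`Hex1.nonempty_and_union_printInd2_eleven`** — at `(λ = 11/14, l = 11)` the datum type is
  INHABITED and, for EVERY datum and EVERY print-dominated `H`, the (P)- and the (U)-inequality over PRINT's (Ind2) **HOLD** (zero gain suffices: the
  row is shallow);
* `Hex1.not_shallow_twentyNine`, **`Hex1.nonempty_and_not_perImage_printInd2_twentyNine`** — at the tabulated level `l = 29` of the same point
  (`log q^{∤{2,29}} = 2·log 231 ≥ 10`, `κ₂₉·10 > 8.5·log π`) the same reading FAILS for every datum (desk: the hex-1 axis flips already between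
  `l = 11` and `l = 13`; the kernel margin with the crude `log π ≤ 2·log 2` is comfortable from `l = 29`).

READING (numbers about OUR typed objects): the print-Ism (Ind2) reading of the cell's Corollary is not identically false on inhabited data — it is
TRUE exactly at the Szpiro-shallow rows (here (11/14, 11)), where the bare Θ-value already pays the gap, and FALSE everywhere else; i.e. it carries
exactly the information of the trivial inequality `κ_l·log q ≤ ((l+5)/4)·log π` and no more. Decided-as-typed ≠ decided in print; (Ind1) strip part,
(Ind3), the log-link, Cor. 3.12 itself untouched; no height bound follows; nothing here asserts that abc is proved or refuted; no side taken.
[cite: Mochizuki2012, IUTchIII Cor. 3.12 p. 173–174; Thm. 3.11 (i) p. 154] [cite: Mochizuki2012, IUTchIV Thm. 1.10 p. 23; Cor. 2.2 (ii) proof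
(P5)(P6)(P7) p. 46] [cite: DupuyHilado2025, §4.7, §4.9, §4.12] [cite: SilvermanAEC2009, Prop. III.1.7(b)] [claim: Mochizuki2012, status: disputed]
for every IUT quotation. Axioms: standard three.
-/

noncomputable section

open NumberField IsDedekindDomain

namespace Literature.IUT.LogVolume.Cor22

open Summit.ABC.IUTFork Summit.ABC.IUTFork.Thm311.Real Literature.NumberTheory.NumberFields
open Literature.NumberTheory.DiophantineGeometry Literature.NumberTheory.DiophantineGeometry.GenEll

namespace Hex1

/-! ## 1. `log q^{∤{2,l}}(11/14)` exactly, and the two numerical sides -/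

/-- The primes of the reduced denominator of `j(11/14)`. [folklore] -/
private theorem primes' : ∀ p ∈ ({3, 7, 11} : Finset ℕ), p.Prime := by
  intro p hp
  simp only [Finset.mem_insert, Finset.mem_singleton] at hp
  rcases hp with rfl | rfl | rfl <;> norm_num

/-- The exponents (all `2`) are nonzero. [folklore] -/
private theorem exp_ne_zero' : ∀ p ∈ ({3, 7, 11} : Finset ℕ), (fun _ : ℕ => 2) p ≠ 0 := fun _ _ => by norm_num

/-- The factorised denominator `53361 = 3²·7²·11²`. [folklore] -/
private theorem den' : (53361 : ℕ) = ∏ p ∈ ({3, 7, 11} : Finset ℕ), p ^ (fun _ : ℕ => 2) p := by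
  rw [Finset.prod_insert (by decide), Finset.prod_insert (by decide), Finset.prod_singleton]
  norm_num

/-- **`j(11/14) = 277167808/53361 = 2⁶·163³/(3·7·11)²`** (`λ = 1/2 + 2/7`; `j(a/c) = 2⁸(a² − ac + c²)³/(abc)²`, triple `3 + 11 = 14`).
[cite: SilvermanAEC2009, Prop. III.1.7(b)] -/
theorem jInv_eq : jInv ((11 : ℚ) / 14) = ((277167808 : ℕ) : ℚ) / ((53361 : ℕ) : ℚ) := by
  norm_num [jInv]

/-- The numerator `2⁶·163³` is prime to `3, 7, 11`. [folklore] -/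
private theorem coprime' : ∀ p ∈ ({3, 7, 11} : Finset ℕ), ¬ p ∣ (277167808 : ℕ) := by
  intro p hp
  simp only [Finset.mem_insert, Finset.mem_singleton] at hp
  rcases hp with rfl | rfl | rfl <;> norm_num

/-- **`log q^{∤{2,l}}(11/14) = Σ_{p ∈ {3,7,11} ∖ {l}} 2·log p`** for every prime `l`. [cite: Mochizuki2012, IUTchIV Thm. 1.10 p. 23]
[claim: Mochizuki2012, status: disputed] -/
theorem logQAvoid_pair_of_prime {l : ℕ} (hl : l.Prime) :
    logQAvoid (ratPoint ((11 : ℚ) / 14)) {2, l} = ∑ p ∈ ({3, 7, 11} : Finset ℕ).erase l, ((2 : ℕ) : ℝ) * Real.log p :=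
  logQAvoid_ratPoint_two_prime_eq_sum primes' exp_ne_zero' den' jInv_eq (by norm_num) coprime' (by decide) hl

/-- **At `l = 11`: `log q^{∤{2,11}}(11/14) = 2·log 3 + 2·log 7 ≤ 6.7`** (`log 3 ≤ log 2 + 1/2`, `log 7 ≤ 2·log 2 + 3/4`, `log 2 < 0.6931471808`).
[cite: Mochizuki2012, IUTchIV Thm. 1.10 p. 23] [claim: Mochizuki2012, status: disputed] -/
theorem logQAvoid_pair_eleven_le : logQAvoid (ratPoint ((11 : ℚ) / 14)) {2, 11} ≤ 6.7 := by
  rw [logQAvoid_pair_of_prime (by norm_num : Nat.Prime 11),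
    show ({3, 7, 11} : Finset ℕ).erase 11 = {3, 7} from by decide,
    Finset.sum_insert (by decide), Finset.sum_singleton]
  have h2 := Real.log_two_lt_d9
  have h3 : Real.log 3 ≤ Real.log 2 + 1 / 2 := by
    rw [show (3 : ℝ) = 2 * (3 / 2) by norm_num, Real.log_mul (by norm_num) (by norm_num)]
    have := Real.log_le_sub_one_of_pos (show (0 : ℝ) < 3 / 2 by norm_num)
    linarith
  have h7 : Real.log 7 ≤ 2 * Real.log 2 + 3 / 4 := by
    rw [show (7 : ℝ) = 2 ^ 2 * (7 / 4) by norm_num, Real.log_mul (by norm_num) (by norm_num), Real.log_pow]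
    have := Real.log_le_sub_one_of_pos (show (0 : ℝ) < 7 / 4 by norm_num)
    push_cast
    linarith
  push_cast
  linarith

/-- **SHALLOW at `l = 11`**: `((11+1)/24 − 1/22)·log q^{∤{2,11}}(11/14) ≤ ((11+5)/4)·log π` (`κ₁₁ = 5/11`, `5/11·6.7 < 4 < 4·log π`).
[cite: Mochizuki2012, IUTchIV Thm. 1.10 Step (viii) p. 30] [claim: Mochizuki2012, status: disputed] -/
theorem shallow_eleven :
    ((((11 : ℕ) : ℝ) + 1) / 24 - 1 / (2 * ((11 : ℕ) : ℝ))) * logQAvoid (ratPoint ((11 : ℚ) / 14)) {2, 11} ≤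
      (((11 : ℕ) : ℝ) + 5) / 4 * Real.log Real.pi := by
  have hQ := logQAvoid_pair_eleven_le
  have hQ0 := logQAvoid_nonneg (ratPoint ((11 : ℚ) / 14)) {2, 11}
  have hpi : 1 < Real.log Real.pi := by
    rw [Real.lt_log_iff_exp_lt Real.pi_pos]
    have := Real.exp_one_lt_d9
    linarith [Real.pi_gt_three]
  push_cast
  nlinarith

/-- **NOT shallow at `l = 29`**: `log q^{∤{2,29}}(11/14) = 2·(log 3 + log 7 + log 11) = 2·log 231 ≥ 10` (`e⁵ < 231`) and
`κ₂₉·10 = (30/24 − 1/58)·10 > (34/4)·log π` (`log π ≤ 2·log 2 < 1.3863`). [cite: Mochizuki2012, IUTchIV Thm. 1.10 Step (viii) p. 30]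
[claim: Mochizuki2012, status: disputed] -/
theorem not_shallow_twentyNine :
    ¬ ((((29 : ℕ) : ℝ) + 1) / 24 - 1 / (2 * ((29 : ℕ) : ℝ))) * logQAvoid (ratPoint ((11 : ℚ) / 14)) {2, 29} ≤
      (((29 : ℕ) : ℝ) + 5) / 4 * Real.log Real.pi := by
  rw [logQAvoid_pair_of_prime (by norm_num : Nat.Prime 29),
    show ({3, 7, 11} : Finset ℕ).erase 29 = {3, 7, 11} from by decide,
    Finset.sum_insert (by decide), Finset.sum_insert (by decide), Finset.sum_singleton]
  have hsum : Real.log 3 + (Real.log 7 + Real.log 11) = Real.log 231 := by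
    rw [← Real.log_mul (by norm_num) (by norm_num), ← Real.log_mul (by norm_num) (by norm_num)]; norm_num
  have h231 : (5 : ℝ) ≤ Real.log 231 := by
    rw [Real.le_log_iff_exp_le (by norm_num)]
    have he := Real.exp_one_lt_d9
    have h5 : Real.exp 5 = Real.exp 1 ^ 5 := by rw [← Real.exp_nat_mul]; norm_num
    rw [h5]
    have hlt : Real.exp 1 ^ 5 < (2.7182818286 : ℝ) ^ 5 := pow_lt_pow_left₀ he (Real.exp_pos 1).le (by norm_num)
    have hnum : (2.7182818286 : ℝ) ^ 5 ≤ 231 := by norm_num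
    linarith
  have hpi : Real.log Real.pi ≤ 2 * Real.log 2 := by
    have h4 : Real.log Real.pi ≤ Real.log 4 := Real.log_le_log Real.pi_pos Real.pi_le_four
    have h22 : Real.log 4 = 2 * Real.log 2 := by
      rw [show (4 : ℝ) = 2 ^ 2 by norm_num, Real.log_pow]; norm_num
    linarith
  have h2 := Real.log_two_lt_d9
  have h3pos : 0 ≤ Real.log 3 := Real.log_nonneg (by norm_num)
  have h7pos : 0 ≤ Real.log 7 := Real.log_nonneg (by norm_num)
  have h11pos : 0 ≤ Real.log 11 := Real.log_nonneg (by norm_num)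
  push_cast
  intro h
  nlinarith

/-! ## 2. Inhabited datum types at `(11/14, 11)` and `(11/14, 29)` -/

/-- The hex `k = 1` carrier is `λ = 1/2 + 2/7 = 11/14`: the datum type at `l = 11` is INHABITED (abc-iut-w6-d102's (P6) list engine through
abc-iut-C-cert-3's junction `Hex.nonempty_and_cor312Of_lamSeven_le_six_tabulated`, by name). [cite: Mochizuki2012, IUTchIV Cor. 2.2 (ii) proof
(P6)(P7) p. 46] [claim: Mochizuki2012, status: disputed] -/
theorem nonempty_eleven : Nonempty (ThetaVolumeDatumAt (ratPoint ((11 : ℚ) / 14)) 11) := by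
  have h := (Conditional.Hex.nonempty_and_cor312Of_lamSeven_le_six_tabulated (k := 1) ⟨le_rfl, by norm_num⟩ 11
    (List.mem_cons_self ..)).1
  have hq : ((2 : ℚ)⁻¹ + 2 / 7 ^ 1) = (11 : ℚ) / 14 := by norm_num
  rw [hq] at h
  exact h

/-- … and at `l = 29`. [cite: Mochizuki2012, IUTchIV Cor. 2.2 (ii) proof (P6)(P7) p. 46] [claim: Mochizuki2012, status: disputed] -/
theorem nonempty_twentyNine : Nonempty (ThetaVolumeDatumAt (ratPoint ((11 : ℚ) / 14)) 29) := by
  have h := (Conditional.Hex.nonempty_and_cor312Of_lamSeven_le_six_tabulated (k := 1) ⟨le_rfl, by norm_num⟩ 29 (by decide)).1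
  have hq : ((2 : ℚ)⁻¹ + 2 / 7 ^ 1) = (11 : ℚ) / 14 := by norm_num
  rw [hq] at h
  exact h

/-! ## 3. The TRUE row `(11/14, l = 11)` and the FALSE row `(11/14, l = 29)` -/

/-- **TRUE ROW, reading (P): at `(λ = 11/14, l = 11)` the genuine datum type is INHABITED AND for EVERY datum and EVERY print-dominated `H` the
per-image inequality over PRINT's (Ind2) HOLDS** (part 7's `perImage_printInd2_iff_shallow`, `.mpr shallow_eleven`).
[cite: Mochizuki2012, IUTchIII Cor. 3.12 p. 173–174; Thm. 3.11 (i) p. 154] [claim: Mochizuki2012, status: disputed] -/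
theorem nonempty_and_perImage_printInd2_eleven :
    Nonempty (ThetaVolumeDatumAt (ratPoint ((11 : ℚ) / 14)) 11) ∧
    ∀ T : ThetaVolumeDatumAt (ratPoint ((11 : ℚ) / 14)) 11,
    letI := T.instFieldF; letI := T.instNumberFieldF; letI := T.instFieldK; letI := T.instNumberFieldK
    letI := T.instAlgebraK; letI := T.instIsElliptic
    ∀ (H : (p : ℕ) → (hp : p.Prime) → (j : ℕ) →
        (e : Fin (j + 1) → placesOver (Literature.IUT.HodgeTheaters.fieldOfModuli T.E) p) →
        haveI : Fact p.Prime := ⟨hp⟩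
        Subgroup (PacketAlgebra p (fun b => (T.I.σ.localFields p).k (e b)) ≃ₗ[ℚ_[p]]
          PacketAlgebra p (fun b => (T.I.σ.localFields p).k (e b)))),
      (∀ (p : ℕ) (hp : p.Prime), haveI : Fact p.Prime := ⟨hp⟩
        ∀ j e, ∀ g ∈ H p hp j e,
          ∃ ψ : ∀ b : Fin (j + 1), Carrier (.inr (T.I.σ.lift (e b).1) : Thm311.Real.Place T.K) ≃ₗ[ℚ]
              Carrier (.inr (T.I.σ.lift (e b).1) : Thm311.Real.Place T.K),
            (∀ b, ψ b ∈ ismIsm (analyticLogv T.K) (T.I.σ.lift (e b).1)) ∧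
            ∀ x : ∀ b, (T.I.σ.localFields p).k (e b),
              (g : PacketAlgebra p (fun b => (T.I.σ.localFields p).k (e b)) ≃ₗ[ℚ_[p]]
                  PacketAlgebra p (fun b => (T.I.σ.localFields p).k (e b))) (PiTensorProduct.tprod ℚ_[p] x) =
                PiTensorProduct.tprod ℚ_[p] (fun b =>
                  RescaledCompletion.of T.K p (T.I.σ.lift (e b).1) (T.I.σ.natCast_mem_lift (e b))
                    (ψ b ((RescaledCompletion.of T.K p (T.I.σ.lift (e b).1) (T.I.σ.natCast_mem_lift (e b))).symm (x b))))) →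
      (T.negAbsLogQ ≤
          (∑ p ∈ T.I.supportPrimes,
            if hp : p.Prime then
              (haveI : Fact p.Prime := ⟨hp⟩
               (T.I.packetAt p hp).lnνLp T.I.lstar (fun j e =>
                 packetHull p (fun b => (T.I.σ.localFields p).k (e b))
                   (⋃ g : H p hp j e, (g : PacketAlgebra p (fun b => (T.I.σ.localFields p).k (e b)) ≃ₗ[ℚ_[p]]
                       PacketAlgebra p (fun b => (T.I.σ.localFields p).k (e b))) ''
                     (T.I.packetAt p hp).pilotRegion (T.I.tΘ p hp) j e)))
            else 0) + ThetaVolumeInput.archLogTheta 11) :=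
  ⟨nonempty_eleven, fun T H hH =>
    (T.perImage_printInd2_iff_shallow (ratPoint_mem_UPle_one (by norm_num) (by norm_num)).1.1 H hH).mpr shallow_eleven⟩

/-- **TRUE ROW, reading (U)** (rational `j`: part 7's `union_printInd2_iff_shallow_of_j_mem_range`). [cite: Mochizuki2012, IUTchIII Cor. 3.12 p. 174]
[claim: Mochizuki2012, status: disputed] -/
theorem nonempty_and_union_printInd2_eleven :
    Nonempty (ThetaVolumeDatumAt (ratPoint ((11 : ℚ) / 14)) 11) ∧
    ∀ T : ThetaVolumeDatumAt (ratPoint ((11 : ℚ) / 14)) 11,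
    letI := T.instFieldF; letI := T.instNumberFieldF; letI := T.instFieldK; letI := T.instNumberFieldK
    letI := T.instAlgebraK; letI := T.instIsElliptic
    ∀ (H : (p : ℕ) → (hp : p.Prime) → (j : ℕ) →
        (e : Fin (j + 1) → placesOver (Literature.IUT.HodgeTheaters.fieldOfModuli T.E) p) →
        haveI : Fact p.Prime := ⟨hp⟩
        Subgroup (PacketAlgebra p (fun b => (T.I.σ.localFields p).k (e b)) ≃ₗ[ℚ_[p]]
          PacketAlgebra p (fun b => (T.I.σ.localFields p).k (e b)))),
      (∀ (p : ℕ) (hp : p.Prime), haveI : Fact p.Prime := ⟨hp⟩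
        ∀ j e, ∀ g ∈ H p hp j e,
          ∃ ψ : ∀ b : Fin (j + 1), Carrier (.inr (T.I.σ.lift (e b).1) : Thm311.Real.Place T.K) ≃ₗ[ℚ]
              Carrier (.inr (T.I.σ.lift (e b).1) : Thm311.Real.Place T.K),
            (∀ b, ψ b ∈ ismIsm (analyticLogv T.K) (T.I.σ.lift (e b).1)) ∧
            ∀ x : ∀ b, (T.I.σ.localFields p).k (e b),
              (g : PacketAlgebra p (fun b => (T.I.σ.localFields p).k (e b)) ≃ₗ[ℚ_[p]]
                  PacketAlgebra p (fun b => (T.I.σ.localFields p).k (e b))) (PiTensorProduct.tprod ℚ_[p] x) =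
                PiTensorProduct.tprod ℚ_[p] (fun b =>
                  RescaledCompletion.of T.K p (T.I.σ.lift (e b).1) (T.I.σ.natCast_mem_lift (e b))
                    (ψ b ((RescaledCompletion.of T.K p (T.I.σ.lift (e b).1) (T.I.σ.natCast_mem_lift (e b))).symm (x b))))) →
      (T.negAbsLogQ ≤
          (∑ p ∈ T.I.supportPrimes,
            if hp : p.Prime then
              (haveI : Fact p.Prime := ⟨hp⟩
               (T.I.packetAt p hp).lnνLp T.I.lstar (fun j e =>
                 packetHull p (fun b => (T.I.σ.localFields p).k (e b))
                   (⋃ g : H p hp j e, (g : PacketAlgebra p (fun b => (T.I.σ.localFields p).k (e b)) ≃ₗ[ℚ_[p]]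
                       PacketAlgebra p (fun b => (T.I.σ.localFields p).k (e b))) ''
                     ⋃ τ : Equiv.Perm (Fin (j + 1)), (T.I.packetAt p hp).perm τ e ''
                       (T.I.packetAt p hp).pilotRegion (T.I.tΘ p hp) j (e ∘ τ))))
            else 0) + ThetaVolumeInput.archLogTheta 11) :=
  ⟨nonempty_eleven, fun T H hH =>
    (T.union_printInd2_iff_shallow_of_j_mem_range (ratPoint_mem_UPle_one (by norm_num) (by norm_num)).1.1
      ⟨jInv ((11 : ℚ) / 14), by
        letI := T.instFieldF; letI := T.instNumberFieldF
        rw [eq_ratCast, T.j_eq]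
        exact (eq_ratCast _ _).symm⟩ H hH).mpr shallow_eleven⟩

/-- **FALSE ROW: at `(λ = 11/14, l = 29)` the datum type is INHABITED and for every datum and every print-dominated `H` the per-image inequality
over PRINT's (Ind2) FAILS** (part 7's criterion `.mp` against `not_shallow_twentyNine`). [cite: Mochizuki2012, IUTchIII Cor. 3.12 p. 173–174]
[claim: Mochizuki2012, status: disputed] -/
theorem nonempty_and_not_perImage_printInd2_twentyNine :
    Nonempty (ThetaVolumeDatumAt (ratPoint ((11 : ℚ) / 14)) 29) ∧
    ∀ T : ThetaVolumeDatumAt (ratPoint ((11 : ℚ) / 14)) 29,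
    letI := T.instFieldF; letI := T.instNumberFieldF; letI := T.instFieldK; letI := T.instNumberFieldK
    letI := T.instAlgebraK; letI := T.instIsElliptic
    ∀ (H : (p : ℕ) → (hp : p.Prime) → (j : ℕ) →
        (e : Fin (j + 1) → placesOver (Literature.IUT.HodgeTheaters.fieldOfModuli T.E) p) →
        haveI : Fact p.Prime := ⟨hp⟩
        Subgroup (PacketAlgebra p (fun b => (T.I.σ.localFields p).k (e b)) ≃ₗ[ℚ_[p]]
          PacketAlgebra p (fun b => (T.I.σ.localFields p).k (e b)))),
      (∀ (p : ℕ) (hp : p.Prime), haveI : Fact p.Prime := ⟨hp⟩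
        ∀ j e, ∀ g ∈ H p hp j e,
          ∃ ψ : ∀ b : Fin (j + 1), Carrier (.inr (T.I.σ.lift (e b).1) : Thm311.Real.Place T.K) ≃ₗ[ℚ]
              Carrier (.inr (T.I.σ.lift (e b).1) : Thm311.Real.Place T.K),
            (∀ b, ψ b ∈ ismIsm (analyticLogv T.K) (T.I.σ.lift (e b).1)) ∧
            ∀ x : ∀ b, (T.I.σ.localFields p).k (e b),
              (g : PacketAlgebra p (fun b => (T.I.σ.localFields p).k (e b)) ≃ₗ[ℚ_[p]]
                  PacketAlgebra p (fun b => (T.I.σ.localFields p).k (e b))) (PiTensorProduct.tprod ℚ_[p] x) =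
                PiTensorProduct.tprod ℚ_[p] (fun b =>
                  RescaledCompletion.of T.K p (T.I.σ.lift (e b).1) (T.I.σ.natCast_mem_lift (e b))
                    (ψ b ((RescaledCompletion.of T.K p (T.I.σ.lift (e b).1) (T.I.σ.natCast_mem_lift (e b))).symm (x b))))) →
      ¬ (T.negAbsLogQ ≤
          (∑ p ∈ T.I.supportPrimes,
            if hp : p.Prime then
              (haveI : Fact p.Prime := ⟨hp⟩
               (T.I.packetAt p hp).lnνLp T.I.lstar (fun j e =>
                 packetHull p (fun b => (T.I.σ.localFields p).k (e b))
                   (⋃ g : H p hp j e, (g : PacketAlgebra p (fun b => (T.I.σ.localFields p).k (e b)) ≃ₗ[ℚ_[p]]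
                       PacketAlgebra p (fun b => (T.I.σ.localFields p).k (e b))) ''
                     (T.I.packetAt p hp).pilotRegion (T.I.tΘ p hp) j e)))
            else 0) + ThetaVolumeInput.archLogTheta 29) :=
  ⟨nonempty_twentyNine, fun T H hH h => not_shallow_twentyNine
    ((T.perImage_printInd2_iff_shallow (ratPoint_mem_UPle_one (by norm_num) (by norm_num)).1.1 H hH).mp h)⟩

end Hex1

end Literature.IUT.LogVolume.Cor22

end
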